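import Literature.Computability.Complexity.RandomizedModularZeroTest
import Literature.Computability.Complexity.ListFoldBricks
import Literature.Computability.Complexity.FoldBricks
import Literature.Computability.Complexity.FPStringBricks
import Literature.Computability.Complexity.BranchingFn
import Literature.Computability.Complexity.PRelSigmaPi
import Literature.Computability.Complexity.IntVectorBricks
import Literature.Computability.AlgebraicComplexity.CircuitCodeReading
import Literature.Computability.AlgebraicComplexity.ConstantFreeValiant
import HarnessLib

/-!
# The randomised identity test for integer circuit CODES: an `FP` evaluator modulo a random number
# (ACIT ∈ coRP on codes — Schwartz 1980, Ibarra–Moran 1983 — the last brick of BIJL18 Thm. 5)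

An `FP` string function `CircuitCode.evalF KP kP` which, on `⟨w, y⟩`, reads the first `KP(|w|)`
coins `y` as a modulus `r` and the next `|w| · kP(|w|)` coins as a point `a ∈ [0, 2^{kP(|w|)})^{|w|}`,
and evaluates the circuit READ OFF THE ARBITRARY STRING `w` (junk-tolerant semantics
`CircuitCode.rdCircuit` / `CircuitCode.semPoly` of `CircuitCodeReading.lean`) at `a` MODULO `r`,
answering `1` iff `r ≤ 1` or the residue is `0` — exactly the evaluator hypothesis of the randomised
modular zero test (`RandomizedModularZeroTest(Height).lean`, Schwartz 1980 §3 / Ibarra–Moran 1983 §4: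
a straight-line program is tested for zero by evaluating it modulo a random number, since its values
have exponentially many bits). The evaluator is assembled in the tree's algebra of `FP` bricks
(`Brick.foldFn` over the items of the coded gate list and of each gate's argument list; `remFn`,
`prodFn`, `addFn`, `subFn`, `binToUnaryFn`, `elemFn`, `takeFn`/`dropFn`, `iteFn`), every remainder
being taken by the NORMALISED modulus (`normF`: value `≥ 2`) so that all intermediate strings stay
linear and the fold bricks' growth conditions hold on every input.

* plumbing: `normF`, `remN`, `constValF` (residue of a constant code `⟨[sign], magnitude⟩`), `opValF`
  (residue of an operand code: gate reference `vals[min ⟦j⟧ |w|]`, constant, variable = block of the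
  point segment), `stepP`/`stepS`/`gateValF` (product and sum gates), `stepG`/`valsF` (the coded list
  of all gate residues), `evalF`;
* **`evalF_mem_FP`**, **`evalF_oneBit`**, and the specification **`evalF_spec`**: for
  `|y| = KP(|w|) + |w|·kP(|w|)`, `evalF KP kP ⟨w, y⟩ = 1 ↔ r ≤ 1 ∨ r ∣ semPoly w (ptOf …)` — proved
  through the invariants `opValF_spec`, `gateValF_spec`, `vals_fold_spec` (the residues follow
  `ArithCircuit.gateValues`, modular arithmetic via `Int.ModEq`).

Consumer: `Barriers/ValiantsHypothesis/BIJL18Thm5Holds.lean` (`{w | semPoly w = 0} ∈ BPP`, agreement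
with `PITLanguage` on the Kabanets–Impagliazzo instances, `BIJL2018_thm5_holds`).

## References

* J. T. Schwartz, *Fast probabilistic algorithms for verification of polynomial identities*, J. ACM 27
  (1980), §3 [Schwartz1980]; O. H. Ibarra, S. Moran, *Probabilistic algorithms for deciding
  equivalence of straight-line programs*, J. ACM 30 (1983), §4 [IbarraMoran1983].
* S. Arora, B. Barak, *Computational Complexity: A Modern Approach*, CUP 2009, §7.2.3, Lemma 7.5, §1.3
  [AroraBarakCC2009].
* V. Kabanets, R. Impagliazzo, Comput. Complexity 13 (2004), §2 (circuits as strings)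
  [KabanetsImpagliazzo2004].
-/

noncomputable section

namespace Literature.Computability.AlgebraicComplexity

namespace CircuitCode

open _root_.Computability Complexity Brick HashBricks Plumb PRelSigma PRelSigPi ArithCircuit ModularZeroTest

/-! ### Normalised modulus and residues -/

/-- The normalised modulus: the string itself if its value is `≥ 2`, else the numeral `2`
(so that every residue taken below has at most as many bits as the modulus string). [folklore] -/
def normF : List Bool → List Bool := iteFn valGeTwoFn id (fun _ => encodeNat 2)

/-- `normF ∈ FP`. [folklore] -/
private theorem normF_mem_FP : normF ∈ FP := iteFn_mem_FP valGeTwoFn_mem_FP OracleCompose.id_mem_FP (const_mem_FP _)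

/-- Value of `normF`. [folklore] -/
private theorem normF_apply (r : List Bool) : normF r = if 2 ≤ bitsToNat r then r else encodeNat 2 := by
  rw [normF, iteFn_apply (show valGeTwoFn r = [decide (2 ≤ bitsToNat r)] from rfl)]
  by_cases h : 2 ≤ bitsToNat r <;> simp [h]

/-- On a modulus `≥ 2` the normalisation is the identity. [folklore] -/
private theorem normF_of_two_le {r : List Bool} (h : 2 ≤ bitsToNat r) : normF r = r := by
  rw [normF_apply, if_pos h]

/-- The normalised modulus has value `≥ 2`. [folklore] -/
private theorem two_le_bitsToNat_normF (r : List Bool) : 2 ≤ bitsToNat (normF r) := by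
  rw [normF_apply]; split_ifs with h
  · exact h
  · simp [bitsToNat_encodeNat]

/-- The normalised modulus is at most two symbols longer. [folklore] -/
private theorem length_normF_le (r : List Bool) : (normF r).length ≤ r.length + 2 := by
  rw [normF_apply]; split_ifs
  · omega
  · have h2 : (encodeNat 2).length = 2 := by decide
    omega

/-- **Residues are short**: `|encodeNat (a % ⟦m⟧)| ≤ |m|` for a modulus string of value `≥ 1`. [folklore] -/
private theorem length_encodeNat_mod_le' (a : ℕ) {m : List Bool} (hm : 1 ≤ bitsToNat m) :
    (encodeNat (a % bitsToNat m)).length ≤ m.length := by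
  rw [TM2Pass.length_encodeNat_eq_size, Nat.size_le]
  exact (Nat.mod_lt a hm).trans (bitsToNat_lt m)

/-- `remN ⟨x, r⟩ = encodeNat (⟦x⟧ % ⟦normF r⟧)`: remainder by the normalised modulus. [folklore] -/
def remN : List Bool → List Bool := remFn ∘ fanoutFn fstF (normF ∘ sndF)

/-- `remN ∈ FP`. [folklore] -/
private theorem remN_mem_FP : remN ∈ FP := comp_mem_FP remFn_mem_FP (fanoutFn_mem_FP fstF_mem_FP (comp_mem_FP normF_mem_FP sndF_mem_FP))

/-- Value of `remN` on a pair. [folklore] -/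
@[simp] private theorem remN_boolPair (x r : List Bool) : remN (boolPair x r) = encodeNat (bitsToNat x % bitsToNat (normF r)) := by
  simp [remN, fanoutFn_apply]

/-- **`remN` never outputs more symbols than the (raw) modulus plus two.** [folklore] -/
private theorem length_remN_le (z : List Bool) : (remN z).length ≤ (sndF z).length + 2 := by
  have h : remN z = encodeNat (bitsToNat (fstF z) % bitsToNat (normF (sndF z))) := by simp [remN, fanoutFn_apply]
  rw [h]
  exact (length_encodeNat_mod_le' _ (by have := two_le_bitsToNat_normF (sndF z); omega)).trans (length_normF_le _)

/-! ### The context and its fields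

The evaluator works on records. Context `ctx = ⟨r, ⟨w, ⟨seg, 1^k⟩⟩⟩` (modulus bits, the input word as a
ruler / variable bound, the point segment, the block length in unary); value context `vc = ⟨vals, ctx⟩`
(`vals` = the body of the residues computed so far); operand argument `s = ⟨opcode, vc⟩`. -/

section Fields

/-- `r` of `ctx`. [folklore] -/
def cR : List Bool → List Bool := fstF
/-- `w` of `ctx`. [folklore] -/
def cW : List Bool → List Bool := fstF ∘ sndF
/-- `seg` of `ctx`. [folklore] -/
def cSeg : List Bool → List Bool := fstF ∘ sndF ∘ sndF
/-- `1^k` of `ctx`. [folklore] -/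
def cK : List Bool → List Bool := sndF ∘ sndF ∘ sndF

/-- Plumbing (`cR_mem_FP`): value/membership bookkeeping for the evaluator bricks. [folklore] -/
private theorem cR_mem_FP : cR ∈ FP := fstF_mem_FP
/-- Plumbing (`cW_mem_FP`): value/membership bookkeeping for the evaluator bricks. [folklore] -/
private theorem cW_mem_FP : cW ∈ FP := comp_mem_FP fstF_mem_FP sndF_mem_FP
/-- Plumbing (`cSeg_mem_FP`): value/membership bookkeeping for the evaluator bricks. [folklore] -/
private theorem cSeg_mem_FP : cSeg ∈ FP := comp_mem_FP fstF_mem_FP (comp_mem_FP sndF_mem_FP sndF_mem_FP)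
/-- Plumbing (`cK_mem_FP`): value/membership bookkeeping for the evaluator bricks. [folklore] -/
private theorem cK_mem_FP : cK ∈ FP := comp_mem_FP sndF_mem_FP (comp_mem_FP sndF_mem_FP sndF_mem_FP)

/-- The context record. [folklore] -/
def mkCtx (r w seg onesk : List Bool) : List Bool := boolPair r (boolPair w (boolPair seg onesk))

/-- Plumbing (`cR_mkCtx`): value/membership bookkeeping for the evaluator bricks. [folklore] -/
@[simp] private theorem cR_mkCtx (r w seg onesk : List Bool) : cR (mkCtx r w seg onesk) = r := by simp [cR, mkCtx]
/-- Plumbing (`cW_mkCtx`): value/membership bookkeeping for the evaluator bricks. [folklore] -/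
@[simp] private theorem cW_mkCtx (r w seg onesk : List Bool) : cW (mkCtx r w seg onesk) = w := by simp [cW, mkCtx]
/-- Plumbing (`cSeg_mkCtx`): value/membership bookkeeping for the evaluator bricks. [folklore] -/
@[simp] private theorem cSeg_mkCtx (r w seg onesk : List Bool) : cSeg (mkCtx r w seg onesk) = seg := by simp [cSeg, mkCtx]
/-- Plumbing (`cK_mkCtx`): value/membership bookkeeping for the evaluator bricks. [folklore] -/
@[simp] private theorem cK_mkCtx (r w seg onesk : List Bool) : cK (mkCtx r w seg onesk) = onesk := by simp [cK, mkCtx]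

end Fields

/-! ### Constants and operands modulo `r` -/

/-- **The residue of a constant code** `q = ⟨ccode, r⟩`, `ccode = ⟨[sign], magnitude⟩`:
`m = ⟦magnitude⟧ % r`, and `(r - m) % r` if the sign bit is set. [folklore] -/
def constValF : List Bool → List Bool :=
  iteFn (headBitFn ∘ fstF ∘ fstF)
    (remN ∘ fanoutFn (subFn ∘ fanoutFn (normF ∘ sndF) (remN ∘ fanoutFn (sndF ∘ fstF) sndF)) sndF)
    (remN ∘ fanoutFn (sndF ∘ fstF) sndF)

/-- `constValF ∈ FP`. [folklore] -/
private theorem constValF_mem_FP : constValF ∈ FP :=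
  iteFn_mem_FP (comp_mem_FP headBitFn_mem_FP (comp_mem_FP fstF_mem_FP fstF_mem_FP))
    (comp_mem_FP remN_mem_FP (fanoutFn_mem_FP
      (comp_mem_FP subFn_mem_FP (fanoutFn_mem_FP (comp_mem_FP normF_mem_FP sndF_mem_FP)
        (comp_mem_FP remN_mem_FP (fanoutFn_mem_FP (comp_mem_FP sndF_mem_FP fstF_mem_FP) sndF_mem_FP))))
      sndF_mem_FP))
    (comp_mem_FP remN_mem_FP (fanoutFn_mem_FP (comp_mem_FP sndF_mem_FP fstF_mem_FP) sndF_mem_FP))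

/-- `constValF` outputs a residue: at most `|r| + 2` symbols. [folklore] -/
private theorem length_constValF_le (q : List Bool) : (constValF q).length ≤ (sndF q).length + 2 := by
  unfold constValF
  rw [iteFn_apply (show (headBitFn ∘ fstF ∘ fstF) q = [_] from headBitFn_apply _)]
  split_ifs
  · rw [Function.comp_apply]
    refine (length_remN_le _).trans ?_
    rw [fanoutFn_apply, sndF_boolPair]
  · rw [Function.comp_apply]
    refine (length_remN_le _).trans ?_
    rw [fanoutFn_apply, sndF_boolPair]

/-- The operand code of `s = ⟨uc, vc⟩`. [folklore] -/
def sUC : List Bool → List Bool := fstF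
/-- The values body of `s = ⟨uc, ⟨vals, ctx⟩⟩`. [folklore] -/
def sVals : List Bool → List Bool := fstF ∘ sndF
/-- The context of `s = ⟨uc, ⟨vals, ctx⟩⟩`. [folklore] -/
def sCtx : List Bool → List Bool := sndF ∘ sndF

/-- Plumbing (`sUC_mem_FP`): value/membership bookkeeping for the evaluator bricks. [folklore] -/
private theorem sUC_mem_FP : sUC ∈ FP := fstF_mem_FP
/-- Plumbing (`sVals_mem_FP`): value/membership bookkeeping for the evaluator bricks. [folklore] -/
private theorem sVals_mem_FP : sVals ∈ FP := comp_mem_FP fstF_mem_FP sndF_mem_FP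
/-- Plumbing (`sCtx_mem_FP`): value/membership bookkeeping for the evaluator bricks. [folklore] -/
private theorem sCtx_mem_FP : sCtx ∈ FP := comp_mem_FP sndF_mem_FP sndF_mem_FP

/-- Gate-reference branch: `vals[min ⟦tail uc⟧ |w|]`. [folklore] -/
def gateBrF : List Bool → List Bool :=
  elemFn ∘ fanoutFn (binToUnaryFn ∘ fanoutFn (cW ∘ sCtx) (List.tail ∘ sUC)) sVals

/-- Constant branch: the residue of the constant `tail (tail uc)`. [folklore] -/
def constBrF : List Bool → List Bool :=
  constValF ∘ fanoutFn (List.tail ∘ List.tail ∘ sUC) (cR ∘ sCtx)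

/-- Variable branch: the residue of block `min ⟦tail (tail uc)⟧ |w|` of the point segment. [folklore] -/
def varBrF : List Bool → List Bool :=
  remN ∘ fanoutFn
    (takeFn ∘ fanoutFn (cK ∘ sCtx)
      (dropFn ∘ fanoutFn (umulFn ∘ fanoutFn (binToUnaryFn ∘ fanoutFn (cW ∘ sCtx) (List.tail ∘ List.tail ∘ sUC))
        (cK ∘ sCtx)) (cSeg ∘ sCtx)))
    (cR ∘ sCtx)

/-- **The residue of an operand** `s = ⟨opcode, ⟨vals, ctx⟩⟩`: tag `1` = gate reference, `01` =
constant, `00` = variable. [folklore] -/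
def opValF : List Bool → List Bool :=
  iteFn (headBitFn ∘ sUC) gateBrF (iteFn (headBitFn ∘ List.tail ∘ sUC) constBrF varBrF)

/-- Plumbing (`gateBrF_mem_FP`): value/membership bookkeeping for the evaluator bricks. [folklore] -/
private theorem gateBrF_mem_FP : gateBrF ∈ FP :=
  comp_mem_FP elemFn_mem_FP (fanoutFn_mem_FP (comp_mem_FP binToUnaryFn_mem_FP
    (fanoutFn_mem_FP (comp_mem_FP cW_mem_FP sCtx_mem_FP) (comp_mem_FP tail_mem_FP sUC_mem_FP))) sVals_mem_FP)

/-- Plumbing (`constBrF_mem_FP`): value/membership bookkeeping for the evaluator bricks. [folklore] -/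
private theorem constBrF_mem_FP : constBrF ∈ FP :=
  comp_mem_FP constValF_mem_FP (fanoutFn_mem_FP
    (comp_mem_FP tail_mem_FP (comp_mem_FP tail_mem_FP sUC_mem_FP)) (comp_mem_FP cR_mem_FP sCtx_mem_FP))

/-- Plumbing (`varBrF_mem_FP`): value/membership bookkeeping for the evaluator bricks. [folklore] -/
private theorem varBrF_mem_FP : varBrF ∈ FP :=
  comp_mem_FP remN_mem_FP (fanoutFn_mem_FP
    (comp_mem_FP takeFn_mem_FP (fanoutFn_mem_FP (comp_mem_FP cK_mem_FP sCtx_mem_FP)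
      (comp_mem_FP dropFn_mem_FP (fanoutFn_mem_FP
        (comp_mem_FP umulFn_mem_FP (fanoutFn_mem_FP
          (comp_mem_FP binToUnaryFn_mem_FP (fanoutFn_mem_FP (comp_mem_FP cW_mem_FP sCtx_mem_FP)
            (comp_mem_FP tail_mem_FP (comp_mem_FP tail_mem_FP sUC_mem_FP))))
          (comp_mem_FP cK_mem_FP sCtx_mem_FP)))
        (comp_mem_FP cSeg_mem_FP sCtx_mem_FP)))))
    (comp_mem_FP cR_mem_FP sCtx_mem_FP))

/-- Plumbing (`opValF_mem_FP`): value/membership bookkeeping for the evaluator bricks. [folklore] -/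
private theorem opValF_mem_FP : opValF ∈ FP :=
  iteFn_mem_FP (comp_mem_FP headBitFn_mem_FP sUC_mem_FP) gateBrF_mem_FP
    (iteFn_mem_FP (comp_mem_FP headBitFn_mem_FP (comp_mem_FP tail_mem_FP sUC_mem_FP)) constBrF_mem_FP varBrF_mem_FP)

/-- **An operand residue is short**: at most `|s| + 2` symbols (a stored value, or a residue). [folklore] -/
private theorem length_opValF_le (s : List Bool) : (opValF s).length ≤ s.length + 2 := by
  have hs := length_fstF_sndF_le s
  have hs2 := length_fstF_sndF_le (sndF s)
  have hs3 := length_fstF_sndF_le (sndF (sndF s))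
  unfold opValF
  rw [iteFn_apply (show (headBitFn ∘ sUC) s = [_] from headBitFn_apply _)]
  split_ifs
  · -- gate reference: an item of `vals`
    rw [gateBrF, Function.comp_apply, fanoutFn_apply, elemFn_boolPair]
    refine (length_elemOf_le _ _).trans ?_
    simp only [sVals, Function.comp_apply]
    omega
  · rw [iteFn_apply (show (headBitFn ∘ List.tail ∘ sUC) s = [_] from headBitFn_apply _)]
    split_ifs
    · rw [constBrF, Function.comp_apply]
      refine (length_constValF_le _).trans ?_
      rw [fanoutFn_apply, sndF_boolPair]
      simp only [cR, sCtx, Function.comp_apply]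
      omega
    · rw [varBrF, Function.comp_apply]
      refine (length_remN_le _).trans ?_
      rw [fanoutFn_apply, sndF_boolPair]
      simp only [cR, sCtx, Function.comp_apply]
      omega


/-! ### Gates: the two inner folds over the argument items

Step argument `v' = ⟨u', ⟨item, acc⟩⟩` with `u' = ⟨vc, argsEnc⟩`, `vc = ⟨vals, ctx⟩`. -/

/-- `vc` of a step argument. [folklore] -/
def pVC : List Bool → List Bool := fstF ∘ fstF
/-- The modulus `r` of a step argument. [folklore] -/
def pR : List Bool → List Bool := cR ∘ sndF ∘ fstF ∘ fstF
/-- The item of a step argument. [folklore] -/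
def pItem : List Bool → List Bool := fstF ∘ sndF
/-- The accumulator of a step argument. [folklore] -/
def pAcc : List Bool → List Bool := sndF ∘ sndF

/-- Plumbing (`pVC_mem_FP`): value/membership bookkeeping for the evaluator bricks. [folklore] -/
private theorem pVC_mem_FP : pVC ∈ FP := comp_mem_FP fstF_mem_FP fstF_mem_FP
/-- Plumbing (`pR_mem_FP`): value/membership bookkeeping for the evaluator bricks. [folklore] -/
private theorem pR_mem_FP : pR ∈ FP := comp_mem_FP cR_mem_FP (comp_mem_FP sndF_mem_FP (comp_mem_FP fstF_mem_FP fstF_mem_FP))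
/-- Plumbing (`pItem_mem_FP`): value/membership bookkeeping for the evaluator bricks. [folklore] -/
private theorem pItem_mem_FP : pItem ∈ FP := comp_mem_FP fstF_mem_FP sndF_mem_FP
/-- Plumbing (`pAcc_mem_FP`): value/membership bookkeeping for the evaluator bricks. [folklore] -/
private theorem pAcc_mem_FP : pAcc ∈ FP := comp_mem_FP sndF_mem_FP sndF_mem_FP

/-- **Product step**: `acc ↦ (acc · opval(item)) mod r`. [folklore] -/
def stepP : List Bool → List Bool :=
  remN ∘ fanoutFn (prodFn ∘ fanoutFn pAcc (opValF ∘ fanoutFn pItem pVC)) pR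

/-- **Sum step**: `acc ↦ (acc + cval(item) · opval(item)) mod r`, the item being `⟨ccode, opcode⟩`. [folklore] -/
def stepS : List Bool → List Bool :=
  remN ∘ fanoutFn (addFn ∘ fanoutFn pAcc
    (prodFn ∘ fanoutFn (constValF ∘ fanoutFn (fstF ∘ pItem) pR) (opValF ∘ fanoutFn (sndF ∘ pItem) pVC))) pR

/-- Plumbing (`stepP_mem_FP`): value/membership bookkeeping for the evaluator bricks. [folklore] -/
private theorem stepP_mem_FP : stepP ∈ FP :=
  comp_mem_FP remN_mem_FP (fanoutFn_mem_FP (comp_mem_FP prodFn_mem_FP (fanoutFn_mem_FP pAcc_mem_FP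
    (comp_mem_FP opValF_mem_FP (fanoutFn_mem_FP pItem_mem_FP pVC_mem_FP)))) pR_mem_FP)

/-- Plumbing (`stepS_mem_FP`): value/membership bookkeeping for the evaluator bricks. [folklore] -/
private theorem stepS_mem_FP : stepS ∈ FP :=
  comp_mem_FP remN_mem_FP (fanoutFn_mem_FP (comp_mem_FP addFn_mem_FP (fanoutFn_mem_FP pAcc_mem_FP
    (comp_mem_FP prodFn_mem_FP (fanoutFn_mem_FP
      (comp_mem_FP constValF_mem_FP (fanoutFn_mem_FP (comp_mem_FP fstF_mem_FP pItem_mem_FP) pR_mem_FP))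
      (comp_mem_FP opValF_mem_FP (fanoutFn_mem_FP (comp_mem_FP sndF_mem_FP pItem_mem_FP) pVC_mem_FP)))))) pR_mem_FP)

/-- The product step outputs a residue: `≤ |r| + 2` symbols. [folklore] -/
private theorem length_stepP_le (v : List Bool) : (stepP v).length ≤ (pR v).length + 2 := by
  rw [stepP, Function.comp_apply]
  refine (length_remN_le _).trans ?_
  rw [fanoutFn_apply, sndF_boolPair]

/-- The sum step outputs a residue: `≤ |r| + 2` symbols. [folklore] -/
private theorem length_stepS_le (v : List Bool) : (stepS v).length ≤ (pR v).length + 2 := by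
  rw [stepS, Function.comp_apply]
  refine (length_remN_le _).trans ?_
  rw [fanoutFn_apply, sndF_boolPair]

/-- `|r| ≤ |u'|` for a step argument. [folklore] -/
private theorem length_pR_le (v : List Bool) : (pR v).length ≤ (fstF v).length := by
  have h1 := length_fstF_sndF_le (fstF v)
  have h2 := length_fstF_sndF_le (fstF (fstF v))
  have h3 := length_fstF_sndF_le (sndF (fstF (fstF v)))
  simp only [pR, cR, Function.comp_apply]
  omega

/-- Plumbing (`foldGrowth_stepP`): value/membership bookkeeping for the evaluator bricks. [folklore] -/
private theorem foldGrowth_stepP : FoldGrowth 2 stepP := fun v => by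
  have h := (length_stepP_le v).trans (Nat.add_le_add_right (length_pR_le v) 2)
  nlinarith [h, Nat.zero_le (sndF (sndF v)).length, Nat.zero_le (fstF (sndF v)).length]

/-- Plumbing (`foldGrowth_stepS`): value/membership bookkeeping for the evaluator bricks. [folklore] -/
private theorem foldGrowth_stepS : FoldGrowth 2 stepS := fun v => by
  have h := (length_stepS_le v).trans (Nat.add_le_add_right (length_pR_le v) 2)
  nlinarith [h, Nat.zero_le (sndF (sndF v)).length, Nat.zero_le (fstF (sndF v)).length]

/-- The input of the inner folds for a gate argument `t = ⟨g, vc⟩`: `⟨vc, sndF (tail g)⟩` (the items of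
the gate code are the items of `sndF (tail g)`). [folklore] -/
def innerInF : List Bool → List Bool := fanoutFn sndF (sndF ∘ List.tail ∘ fstF)

/-- Plumbing (`innerInF_mem_FP`): value/membership bookkeeping for the evaluator bricks. [folklore] -/
private theorem innerInF_mem_FP : innerInF ∈ FP :=
  fanoutFn_mem_FP sndF_mem_FP (comp_mem_FP sndF_mem_FP (comp_mem_FP tail_mem_FP fstF_mem_FP))

/-- **The residue of a product gate**. [folklore] -/
def prodValF : List Bool → List Bool := foldFn stepP (fun _ => [true]) ∘ innerInF
/-- **The residue of a sum gate**. [folklore] -/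
def sumValF : List Bool → List Bool := foldFn stepS (fun _ => []) ∘ innerInF
/-- **The residue of a gate** `t = ⟨g, vc⟩` (tag bit `1` = product). [folklore] -/
def gateValF : List Bool → List Bool := iteFn (headBitFn ∘ fstF) prodValF sumValF

/-- Plumbing (`prodValF_mem_FP`): value/membership bookkeeping for the evaluator bricks. [folklore] -/
private theorem prodValF_mem_FP : prodValF ∈ FP :=
  comp_mem_FP (foldFn_mem_FP stepP_mem_FP (const_mem_FP _) foldGrowth_stepP) innerInF_mem_FP
/-- Plumbing (`sumValF_mem_FP`): value/membership bookkeeping for the evaluator bricks. [folklore] -/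
private theorem sumValF_mem_FP : sumValF ∈ FP :=
  comp_mem_FP (foldFn_mem_FP stepS_mem_FP (const_mem_FP _) foldGrowth_stepS) innerInF_mem_FP
/-- Plumbing (`gateValF_mem_FP`): value/membership bookkeeping for the evaluator bricks. [folklore] -/
private theorem gateValF_mem_FP : gateValF ∈ FP :=
  iteFn_mem_FP (comp_mem_FP headBitFn_mem_FP fstF_mem_FP) prodValF_mem_FP sumValF_mem_FP

/-- A left fold whose steps all output at most `M` symbols ends with at most `M` symbols
(given the start has). [folklore] -/
private theorem length_foldl_le {step : List Bool → List Bool → List Bool} {M : ℕ}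
    (hstep : ∀ acc a, (step acc a).length ≤ M) : ∀ (L : List (List Bool)) (acc : List Bool),
    acc.length ≤ M → (L.foldl step acc).length ≤ M
  | [], _, h => h
  | a :: L, acc, _ => length_foldl_le hstep L _ (hstep acc a)

/-- **A gate residue is short**: `≤ |ctx| + 2` symbols, for `t = ⟨g, ⟨vals, ctx⟩⟩`. [folklore] -/
private theorem length_gateValF_le (t : List Bool) : (gateValF t).length ≤ (sndF (sndF t)).length + 2 := by
  have hR : ∀ item acc : List Bool, (pR (boolPair (innerInF t) (boolPair item acc))).length ≤ (sndF (sndF t)).length := by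
    intro item acc
    have := length_fstF_sndF_le (sndF (sndF t))
    simp only [pR, cR, innerInF, Function.comp_apply, fanoutFn_apply, fstF_boolPair]
    omega
  unfold gateValF
  rw [iteFn_apply (show (headBitFn ∘ fstF) t = [_] from headBitFn_apply _)]
  split_ifs
  · rw [prodValF, Function.comp_apply, foldFn_apply]
    refine length_foldl_le (fun acc a => ?_) _ _ (by simp)
    exact (length_stepP_le _).trans (by have := hR a acc; omega)
  · rw [sumValF, Function.comp_apply, foldFn_apply]
    refine length_foldl_le (fun acc a => ?_) _ _ (by simp)
    exact (length_stepS_le _).trans (by have := hR a acc; omega)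

/-! ### The outer fold over the gate codes

Step argument `v = ⟨u, ⟨g, vals⟩⟩` with `u = ⟨ctx, gatesEnc⟩`; the new list of residues is
`vals ++ ⟨gateval, ε⟩` (one more frame of the coded list). -/

/-- The frame of one list item: `x ↦ ⟨x, ε⟩`. [folklore] -/
def frameF : List Bool → List Bool := fanoutFn id (fun _ => [])

/-- Plumbing (`frameF_mem_FP`): value/membership bookkeeping for the evaluator bricks. [folklore] -/
private theorem frameF_mem_FP : frameF ∈ FP := fanoutFn_mem_FP OracleCompose.id_mem_FP (const_mem_FP _)

/-- Plumbing (`frameF_apply`): value/membership bookkeeping for the evaluator bricks. [folklore] -/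
@[simp] private theorem frameF_apply (x : List Bool) : frameF x = boolPair x [] := by simp [frameF, fanoutFn_apply]

/-- The gate argument `⟨g, ⟨vals, ctx⟩⟩` assembled from the outer step argument. [folklore] -/
def gArgF : List Bool → List Bool := fanoutFn (fstF ∘ sndF) (fanoutFn (sndF ∘ sndF) (fstF ∘ fstF))

/-- Plumbing (`gArgF_mem_FP`): value/membership bookkeeping for the evaluator bricks. [folklore] -/
private theorem gArgF_mem_FP : gArgF ∈ FP :=
  fanoutFn_mem_FP (comp_mem_FP fstF_mem_FP sndF_mem_FP)
    (fanoutFn_mem_FP (comp_mem_FP sndF_mem_FP sndF_mem_FP) (comp_mem_FP fstF_mem_FP fstF_mem_FP))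

/-- **Outer step**: append the frame of the residue of gate `g` to `vals`. [folklore] -/
def stepG : List Bool → List Bool := fun v => sndF (sndF v) ++ (frameF ∘ gateValF ∘ gArgF) v

/-- Plumbing (`stepG_mem_FP`): value/membership bookkeeping for the evaluator bricks. [folklore] -/
private theorem stepG_mem_FP : stepG ∈ FP :=
  append_mem_FP (comp_mem_FP sndF_mem_FP sndF_mem_FP)
    (comp_mem_FP frameF_mem_FP (comp_mem_FP gateValF_mem_FP gArgF_mem_FP))

/-- Plumbing (`foldGrowth_stepG`): value/membership bookkeeping for the evaluator bricks. [folklore] -/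
private theorem foldGrowth_stepG : FoldGrowth 6 stepG := fun v => by
  have h1 := length_gateValF_le (gArgF v)
  have hctx : (sndF (sndF (gArgF v))).length ≤ (fstF v).length := by
    have := length_fstF_sndF_le (fstF v)
    simp only [gArgF, fanoutFn_apply, sndF_boolPair, Function.comp_apply]
    omega
  have hlen : (stepG v).length = (sndF (sndF v)).length + (2 * (gateValF (gArgF v)).length + 2) := by
    simp only [stepG, Function.comp_apply, frameF_apply, List.length_append, length_boolPair, List.length_nil]
  rw [hlen]
  nlinarith [Nat.zero_le (fstF (sndF v)).length]

/-! ### The evaluator -/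

section Evaluator

variable (KP kP : Polynomial ℕ)

/-- The modulus bits: the first `K(|w|)` coins. [folklore] -/
def rRawF : List Bool → List Bool := takeFn ∘ fanoutFn (polyFn KP ∘ fstF) sndF
/-- The point segment: the coins after the first `K(|w|)`. [folklore] -/
def segF : List Bool → List Bool := dropFn ∘ fanoutFn (polyFn KP ∘ fstF) sndF
/-- The context `⟨r, ⟨w, ⟨seg, 1^{k(|w|)}⟩⟩⟩` of an input `⟨w, y⟩`. [folklore] -/
def ctxF : List Bool → List Bool :=
  fanoutFn (rRawF KP) (fanoutFn fstF (fanoutFn (segF KP) (polyFn kP ∘ fstF)))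
/-- The input of the outer fold: `⟨ctx, gate list code of w⟩`. [folklore] -/
def outerInF : List Bool → List Bool := fanoutFn (ctxF KP kP) (sndF ∘ fstF ∘ sndF ∘ fstF)
/-- The coded list of all gate residues. [folklore] -/
def valsF : List Bool → List Bool := foldFn stepG (fun _ => []) ∘ outerInF KP kP
/-- The residue of the output operand. [folklore] -/
def outValF : List Bool → List Bool :=
  opValF ∘ fanoutFn (sndF ∘ sndF ∘ fstF) (fanoutFn (valsF KP kP) (ctxF KP kP))
/-- **The evaluator**: `1` iff the modulus is `≤ 1` or the circuit read off `w` vanishes modulo it at the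
point read off the coins. [cite: Schwartz1980, §3] -/
def evalF : List Bool → List Bool :=
  iteFn (valGeTwoFn ∘ rRawF KP) (isNilFn ∘ outValF KP kP) (fun _ => [true])

/-- Plumbing (`rRawF_mem_FP`): value/membership bookkeeping for the evaluator bricks. [folklore] -/
private theorem rRawF_mem_FP : rRawF KP ∈ FP :=
  comp_mem_FP takeFn_mem_FP (fanoutFn_mem_FP (comp_mem_FP (polyFn_mem_FP KP) fstF_mem_FP) sndF_mem_FP)
/-- Plumbing (`segF_mem_FP`): value/membership bookkeeping for the evaluator bricks. [folklore] -/
private theorem segF_mem_FP : segF KP ∈ FP :=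
  comp_mem_FP dropFn_mem_FP (fanoutFn_mem_FP (comp_mem_FP (polyFn_mem_FP KP) fstF_mem_FP) sndF_mem_FP)
/-- Plumbing (`ctxF_mem_FP`): value/membership bookkeeping for the evaluator bricks. [folklore] -/
private theorem ctxF_mem_FP : ctxF KP kP ∈ FP :=
  fanoutFn_mem_FP (rRawF_mem_FP KP) (fanoutFn_mem_FP fstF_mem_FP
    (fanoutFn_mem_FP (segF_mem_FP KP) (comp_mem_FP (polyFn_mem_FP kP) fstF_mem_FP)))
/-- Plumbing (`outerInF_mem_FP`): value/membership bookkeeping for the evaluator bricks. [folklore] -/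
private theorem outerInF_mem_FP : outerInF KP kP ∈ FP :=
  fanoutFn_mem_FP (ctxF_mem_FP KP kP)
    (comp_mem_FP sndF_mem_FP (comp_mem_FP fstF_mem_FP (comp_mem_FP sndF_mem_FP fstF_mem_FP)))
/-- Plumbing (`valsF_mem_FP`): value/membership bookkeeping for the evaluator bricks. [folklore] -/
private theorem valsF_mem_FP : valsF KP kP ∈ FP :=
  comp_mem_FP (foldFn_mem_FP stepG_mem_FP (const_mem_FP _) foldGrowth_stepG) (outerInF_mem_FP KP kP)
/-- Plumbing (`outValF_mem_FP`): value/membership bookkeeping for the evaluator bricks. [folklore] -/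
private theorem outValF_mem_FP : outValF KP kP ∈ FP :=
  comp_mem_FP opValF_mem_FP (fanoutFn_mem_FP (comp_mem_FP sndF_mem_FP (comp_mem_FP sndF_mem_FP fstF_mem_FP))
    (fanoutFn_mem_FP (valsF_mem_FP KP kP) (ctxF_mem_FP KP kP)))

/-- **The evaluator is in `FP`.** [cite: AroraBarakCC2009, §1.3] -/
theorem evalF_mem_FP : evalF KP kP ∈ FP :=
  iteFn_mem_FP (comp_mem_FP valGeTwoFn_mem_FP (rRawF_mem_FP KP))
    (comp_mem_FP isNilFn_mem_FP (outValF_mem_FP KP kP)) (const_mem_FP _)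

/-- **The evaluator is one-bit** (an `iteFn` of one-bit bricks). [cite: AroraBarakCC2009, §1.3] -/
theorem evalF_oneBit (z : List Bool) : evalF KP kP z = [true] ∨ evalF KP kP z = [false] := by
  obtain ⟨b, hb⟩ := (oneBit_valGeTwoFn.comp (rRawF KP)).ite (oneBit_isNilFn.comp (outValF KP kP))
    (oneBit_const true) z
  rw [evalF, hb]; cases b <;> simp

end Evaluator


/-! ### Semantics: residues, coded value lists, modular arithmetic -/

section Semantics

open MvPolynomial

/-- The numeral of the residue of an integer modulo `r`. [folklore] -/
def numR (r : ℕ) (z : ℤ) : List Bool := encodeNat (z % (r : ℤ)).toNat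

/-- The coded list of the residues of the values of a list of polynomials at `pt`. [folklore] -/
def valEnc {V : ℕ} (r : ℕ) (pt : Fin V → ℤ) (L : List (MvPolynomial (Fin V) ℤ)) : List Bool :=
  encList (L.map fun p => numR r (MvPolynomial.eval pt p))

variable {r : ℕ}

/-- The residue is the remainder, as an integer. [folklore] -/
private theorem cast_toNat_emod (hr : 1 ≤ r) (z : ℤ) : (((z % (r : ℤ)).toNat : ℕ) : ℤ) = z % (r : ℤ) :=
  Int.toNat_of_nonneg (Int.emod_nonneg _ (by exact_mod_cast (show r ≠ 0 by omega)))

/-- Value of `numR`. [folklore] -/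
@[simp] private theorem bitsToNat_numR (z : ℤ) : bitsToNat (numR r z) = (z % (r : ℤ)).toNat := by
  simp [numR, bitsToNat_encodeNat]

/-- `numR` of a natural number. [folklore] -/
private theorem numR_natCast (n : ℕ) : numR r (n : ℤ) = encodeNat (n % r) := by
  rw [numR, ← Int.natCast_mod, Int.toNat_natCast]

/-- `numR r 0 = ε`. [folklore] -/
@[simp] private theorem numR_zero : numR r 0 = [] := by
  rw [show (0 : ℤ) = ((0 : ℕ) : ℤ) by simp, numR_natCast, Nat.zero_mod]; rfl

/-- `numR r 1 = [1]` for `r ≥ 2`. [folklore] -/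
private theorem numR_one (hr : 2 ≤ r) : numR r 1 = [true] := by
  have : (1 : ℤ) % (r : ℤ) = 1 := Int.emod_eq_of_lt (by norm_num) (by exact_mod_cast hr)
  rw [numR, this]; decide

/-- `numR r z = ε ↔ r ∣ z`. [folklore] -/
private theorem numR_eq_nil_iff (hr : 1 ≤ r) (z : ℤ) : numR r z = [] ↔ (r : ℤ) ∣ z := by
  have h0 : 0 ≤ z % (r : ℤ) := Int.emod_nonneg _ (by exact_mod_cast (show r ≠ 0 by omega))
  rw [numR, Int.dvd_iff_emod_eq_zero]
  constructor
  · intro h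
    have h1 : (z % (r : ℤ)).toNat = 0 := by
      have := congrArg bitsToNat h; simpa [bitsToNat_encodeNat] using this
    omega
  · intro h; rw [h]; rfl

/-- **Modular sum-of-product step.** [folklore] -/
private theorem addmul_res (hr : 1 ≤ r) (S c o : ℤ) :
    ((S % (r:ℤ)).toNat + (c % (r:ℤ)).toNat * (o % (r:ℤ)).toNat) % r = ((S + c * o) % (r:ℤ)).toNat := by
  have hS := cast_toNat_emod hr S
  have hc := cast_toNat_emod hr c
  have ho := cast_toNat_emod hr o
  have hres := cast_toNat_emod hr (S + c * o)
  have hmod : (S % r + (c % r) * (o % r)) % (r : ℤ) = (S + c * o) % r :=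
    ((Int.mod_modEq S r).add ((Int.mod_modEq c r).mul (Int.mod_modEq o r)))
  have h : ((((S % (r:ℤ)).toNat + (c % (r:ℤ)).toNat * (o % (r:ℤ)).toNat) % r : ℕ) : ℤ) =
      ((((S + c * o) % (r:ℤ)).toNat : ℕ) : ℤ) := by
    rw [Int.natCast_mod, Nat.cast_add, Nat.cast_mul, hS, hc, ho, hres, hmod]
  exact_mod_cast h

/-- **Modular product step.** [folklore] -/
private theorem mul_res (hr : 1 ≤ r) (P o : ℤ) :
    ((P % (r:ℤ)).toNat * (o % (r:ℤ)).toNat) % r = ((P * o) % (r:ℤ)).toNat := by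
  have h := addmul_res hr 0 P o
  simpa using h

/-- **Negation of a residue**: `(r - m % r) % r` is the residue of `-m`. [folklore] -/
private theorem neg_res (hr : 1 ≤ r) (m : ℕ) : (r - m % r) % r = ((-(m : ℤ)) % (r : ℤ)).toNat := by
  have hlt : m % r ≤ r := (Nat.mod_lt m hr).le
  have hres := cast_toNat_emod hr (-(m : ℤ))
  have hmod : ((r : ℤ) - (m : ℤ) % r) % (r : ℤ) = (-(m : ℤ)) % r := by
    have h1 : (r : ℤ) ≡ 0 [ZMOD r] := by simp [Int.ModEq]
    have h2 := (h1.sub (Int.mod_modEq (m : ℤ) r))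
    rw [zero_sub] at h2
    exact h2
  have h : (((r - m % r) % r : ℕ) : ℤ) = ((((-(m : ℤ)) % (r : ℤ)).toNat : ℕ) : ℤ) := by
    rw [Int.natCast_mod, Nat.cast_sub hlt, Int.natCast_mod, hres, hmod]
  exact_mod_cast h

/-- List access on a coded list. [folklore] -/
private theorem elemOf_encList : ∀ (l : List (List Bool)) (i : ℕ), elemOf (encList l) i = l.getD i []
  | [], i => by
    induction i with
    | zero => simp [elemOf, encList_nil, fstP, boolUnpair]
    | succ i ih =>
      simp only [elemOf, Function.iterate_succ_apply, encList_nil] at ih ⊢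
      have : sndP ([] : List Bool) = [] := by simp [sndP, boolUnpair]
      rw [this]; simpa using ih
  | a :: l, 0 => by simp [elemOf, encList_cons, fstP_boolPair]
  | a :: l, i + 1 => by
    rw [elemOf, Function.iterate_succ_apply, encList_cons, sndP_boolPair, ← elemOf, elemOf_encList l i]
    simp

/-- Appending an item to a coded list appends its frame. [folklore] -/
private theorem encList_append_singleton (l : List (List Bool)) (x : List Bool) :
    encList (l ++ [x]) = encList l ++ boolPair x [] := by
  induction l with
  | nil => simp [encList_cons, encList_nil]
  | cons a l ih => rw [List.cons_append, encList_cons, encList_cons, ih]; simp [boolPair, List.append_assoc]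

variable {V k : ℕ} {w rb seg : List Bool}

/-- **The residue of a constant code.** [folklore] -/
private theorem constValF_spec (hr : 2 ≤ bitsToNat rb) (cc : List Bool) :
    constValF (boolPair cc rb) = numR (bitsToNat rb) (rdInt cc) := by
  have hr1 : 1 ≤ bitsToNat rb := by omega
  rw [constValF, iteFn_apply (c := headBitFn ∘ fstF ∘ fstF) (b := (fstF cc).headD false)
    (by rw [Function.comp_apply, Function.comp_apply, fstF_boolPair, headBitFn_apply])]
  unfold rdInt
  by_cases hs : (fstF cc).headD false = true
  · rw [if_pos hs, if_pos hs]
    simp only [Function.comp_apply, fanoutFn_apply, remN_boolPair, sndF_boolPair, subFn_boolPair, fstF_boolPair,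
      normF_of_two_le hr, bitsToNat_encodeNat, numR]
    rw [neg_res hr1]
  · rw [if_neg hs, if_neg hs]
    simp only [Function.comp_apply, fanoutFn_apply, remN_boolPair, sndF_boolPair, fstF_boolPair,
      normF_of_two_le hr]
    rw [numR_natCast]

/-- **The residue of an operand code** against the coded residues of the earlier values.
[folklore] -/
private theorem opValF_spec (hV : V = w.length) (hr : 2 ≤ bitsToNat rb) (hseg : seg.length = V * k)
    (L : List (MvPolynomial (Fin V) ℤ)) (hL : L.length ≤ w.length) (uc : List Bool) :
    opValF (boolPair uc (boolPair (valEnc (bitsToNat rb) (ptOf k V seg) L) (mkCtx rb w seg (ones k)))) =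
      numR (bitsToNat rb) (MvPolynomial.eval (ptOf k V seg) ((rdOp V uc).eval L)) := by
  have hr1 : 1 ≤ bitsToNat rb := by omega
  set vc := boolPair (valEnc (bitsToNat rb) (ptOf k V seg) L) (mkCtx rb w seg (ones k)) with hvc
  rw [opValF, iteFn_apply (c := headBitFn ∘ sUC) (b := uc.headD false)
    (by rw [Function.comp_apply, sUC, fstF_boolPair, headBitFn_apply])]
  unfold rdOp
  by_cases h0 : uc.headD false = true
  · -- gate reference
    rw [if_pos h0, if_pos h0]
    simp only [gateBrF, Function.comp_apply, fanoutFn_apply, sCtx, sVals, sUC, fstF_boolPair, sndF_boolPair,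
      hvc, cW_mkCtx, elemFn_boolPair, binToUnaryFn_boolPair, Operand.eval, valEnc]
    rw [elemOf_encList, List.getD_eq_getElem?_getD, List.getD_eq_getElem?_getD, List.getElem?_map]
    simp only [ones, List.length_replicate]
    by_cases hj : bitsToNat uc.tail < L.length
    · rw [min_eq_left (by omega), List.getElem?_eq_getElem hj]
      simp
    · rw [List.getElem?_eq_none (by simp; omega), List.getElem?_eq_none (by omega)]
      simp
  · rw [if_neg h0, if_neg h0, iteFn_apply (c := headBitFn ∘ List.tail ∘ sUC) (b := uc.tail.headD false)
      (by rw [Function.comp_apply, Function.comp_apply, sUC, fstF_boolPair, headBitFn_apply])]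
    by_cases h1 : uc.tail.headD false = true
    · -- constant
      rw [if_pos h1, if_pos h1]
      simp only [constBrF, Function.comp_apply, fanoutFn_apply, sUC, sCtx, fstF_boolPair, sndF_boolPair, hvc,
        cR_mkCtx, constValF_spec hr, Operand.eval, eval_C]
    · rw [if_neg h1, if_neg h1]
      simp only [varBrF, Function.comp_apply, fanoutFn_apply, sUC, sCtx, fstF_boolPair, sndF_boolPair, hvc,
        cW_mkCtx, cK_mkCtx, cSeg_mkCtx, cR_mkCtx, binToUnaryFn_boolPair, umulFn_apply, dropFn_boolPair,
        takeFn_boolPair, remN_boolPair, normF_of_two_le hr]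
      simp only [ones, List.length_replicate]
      by_cases h2 : bitsToNat uc.tail.tail < V
      · rw [dif_pos h2, min_eq_left (by omega)]
        simp only [Operand.eval, eval_X, ptOf, blockOf]
        rw [numR_natCast]
      · rw [dif_neg h2, min_eq_right (by omega), ← hV, List.drop_eq_nil_of_le (by rw [hseg])]
        simp only [List.take_nil, bitsToNat_nil, Nat.zero_mod, Operand.eval, map_zero, numR_zero]
        rfl

end Semantics

/-! ### Semantics of the folds and of the evaluator -/

section FoldSpecs

open MvPolynomial

variable {V k : ℕ} {w rb seg : List Bool}

/-- Value of `innerInF` on a gate argument. [folklore] -/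
private theorem innerInF_boolPair (g vc : List Bool) : innerInF (boolPair g vc) = boolPair vc (sndF g.tail) := by
  simp [innerInF, fanoutFn_apply]

/-- Value of the product step on a structured argument. [folklore] -/
private theorem stepP_boolPair (vals ctx argsEnc a acc : List Bool) :
    stepP (boolPair (boolPair (boolPair vals ctx) argsEnc) (boolPair a acc)) =
      remN (boolPair (prodFn (boolPair acc (opValF (boolPair a (boolPair vals ctx))))) (cR ctx)) := by
  simp [stepP, fanoutFn_apply, pAcc, pItem, pVC, pR]

/-- Value of the sum step on a structured argument. [folklore] -/
private theorem stepS_boolPair (vals ctx argsEnc a acc : List Bool) :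
    stepS (boolPair (boolPair (boolPair vals ctx) argsEnc) (boolPair a acc)) =
      remN (boolPair (addFn (boolPair acc (prodFn (boolPair (constValF (boolPair (fstF a) (cR ctx)))
        (opValF (boolPair (sndF a) (boolPair vals ctx))))))) (cR ctx)) := by
  simp [stepS, fanoutFn_apply, pAcc, pItem, pVC, pR]

/-- **The product fold computes the residue of the product.** [folklore] -/
private theorem prod_fold_spec (hV : V = w.length) (hr : 2 ≤ bitsToNat rb) (hseg : seg.length = V * k)
    (L : List (MvPolynomial (Fin V) ℤ)) (hL : L.length ≤ w.length) (argsEnc : List Bool) :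
    ∀ (I : List (List Bool)) (P : ℤ),
      I.foldl (fun acc a => stepP (boolPair (boolPair (boolPair (valEnc (bitsToNat rb) (ptOf k V seg) L)
        (mkCtx rb w seg (ones k))) argsEnc) (boolPair a acc))) (numR (bitsToNat rb) P) =
      numR (bitsToNat rb) (P * (I.map fun a => MvPolynomial.eval (ptOf k V seg) ((rdOp V a).eval L)).prod)
  | [], P => by simp
  | a :: I, P => by
    have hr1 : 1 ≤ bitsToNat rb := by omega
    rw [List.foldl_cons, stepP_boolPair, opValF_spec hV hr hseg L hL a, cR_mkCtx,
      remN_boolPair, prodFn_boolPair, bitsToNat_numR, bitsToNat_numR, bitsToNat_encodeNat, normF_of_two_le hr,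
      mul_res hr1, ← numR, prod_fold_spec hV hr hseg L hL argsEnc I, List.map_cons, List.prod_cons, mul_assoc]

/-- **The sum fold computes the residue of the weighted sum.** [folklore] -/
private theorem sum_fold_spec (hV : V = w.length) (hr : 2 ≤ bitsToNat rb) (hseg : seg.length = V * k)
    (L : List (MvPolynomial (Fin V) ℤ)) (hL : L.length ≤ w.length) (argsEnc : List Bool) :
    ∀ (I : List (List Bool)) (S : ℤ),
      I.foldl (fun acc a => stepS (boolPair (boolPair (boolPair (valEnc (bitsToNat rb) (ptOf k V seg) L)
        (mkCtx rb w seg (ones k))) argsEnc) (boolPair a acc))) (numR (bitsToNat rb) S) =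
      numR (bitsToNat rb) (S + (I.map fun a =>
        rdInt (fstF a) * MvPolynomial.eval (ptOf k V seg) ((rdOp V (sndF a)).eval L)).sum)
  | [], S => by simp
  | a :: I, S => by
    have hr1 : 1 ≤ bitsToNat rb := by omega
    rw [List.foldl_cons, stepS_boolPair, opValF_spec hV hr hseg L hL (sndF a), cR_mkCtx,
      constValF_spec hr, remN_boolPair, addFn_boolPair, prodFn_boolPair, bitsToNat_numR, bitsToNat_numR,
      bitsToNat_numR, bitsToNat_encodeNat, bitsToNat_encodeNat, normF_of_two_le hr, addmul_res hr1, ← numR,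
      sum_fold_spec hV hr hseg L hL argsEnc I, List.map_cons, List.sum_cons, add_assoc]

/-- **The gate brick computes the residue of the gate's value.** [folklore] -/
private theorem gateValF_spec (hV : V = w.length) (hr : 2 ≤ bitsToNat rb) (hseg : seg.length = V * k)
    (L : List (MvPolynomial (Fin V) ℤ)) (hL : L.length ≤ w.length) (g : List Bool) :
    gateValF (boolPair g (boolPair (valEnc (bitsToNat rb) (ptOf k V seg) L) (mkCtx rb w seg (ones k)))) =
      numR (bitsToNat rb) (MvPolynomial.eval (ptOf k V seg) ((rdGate V g).eval L)) := by
  have hr1 : 1 ≤ bitsToNat rb := by omega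
  rw [gateValF, iteFn_apply (c := headBitFn ∘ fstF) (b := g.headD false)
    (by rw [Function.comp_apply, fstF_boolPair, headBitFn_apply])]
  unfold rdGate rdItems
  by_cases ht : g.headD false = true
  · rw [if_pos ht, if_pos ht, prodValF, Function.comp_apply, innerInF_boolPair, foldFn_boolPair,
      ← numR_one hr, prod_fold_spec hV hr hseg L hL, one_mul]
    simp only [Gate.eval, List.map_map, map_list_prod]
    rfl
  · rw [if_neg ht, if_neg ht, sumValF, Function.comp_apply, innerInF_boolPair, foldFn_boolPair,
      ← numR_zero (r := bitsToNat rb), sum_fold_spec hV hr hseg L hL, zero_add]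
    simp only [Gate.eval, List.map_map, map_list_sum]
    congr 2
    refine List.map_congr_left fun a _ => ?_
    simp

/-- Value of the outer step on a structured argument. [folklore] -/
private theorem stepG_boolPair (ctx gatesEnc g vals : List Bool) :
    stepG (boolPair (boolPair ctx gatesEnc) (boolPair g vals)) = vals ++ boolPair (gateValF (boolPair g (boolPair vals ctx))) [] := by
  simp [stepG, gArgF, fanoutFn_apply, frameF_apply]

/-- **The outer fold computes the coded list of all gate residues.** [folklore] -/
private theorem vals_fold_spec (hV : V = w.length) (hr : 2 ≤ bitsToNat rb) (hseg : seg.length = V * k)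
    (gatesEnc : List Bool) : ∀ codes : List (List Bool), codes.length ≤ w.length →
      codes.foldl (fun acc g => stepG (boolPair (boolPair (mkCtx rb w seg (ones k)) gatesEnc) (boolPair g acc))) [] =
        valEnc (bitsToNat rb) (ptOf k V seg) (gateValues (codes.map (rdGate V))) := by
  intro codes
  induction codes using List.reverseRecOn with
  | nil => intro _; simp [valEnc, gateValues, encList_nil]
  | append_singleton codes g ih =>
    intro hlen
    rw [List.length_append, List.length_singleton] at hlen
    rw [List.foldl_append, ih (by omega), List.foldl_cons, List.foldl_nil, stepG_boolPair,
      gateValF_spec hV hr hseg _ (by rw [gateValues_length, List.length_map]; omega),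
      List.map_append, List.map_singleton, gateValues_append_singleton, valEnc, valEnc, List.map_append,
      List.map_singleton, encList_append_singleton]

variable (KP kP : Polynomial ℕ)

/-- Value of the modulus reader. [folklore] -/
private theorem rRawF_boolPair (w y : List Bool) : rRawF KP (boolPair w y) = y.take (KP.eval w.length) := by
  simp [rRawF, fanoutFn_apply, takeFn_boolPair, polyFn_apply, ones]

/-- Value of the context. [folklore] -/
private theorem ctxF_boolPair (w y : List Bool) :
    ctxF KP kP (boolPair w y) = mkCtx (y.take (KP.eval w.length)) w (y.drop (KP.eval w.length)) (ones (kP.eval w.length)) := by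
  simp [ctxF, mkCtx, rRawF, segF, fanoutFn_apply, takeFn_boolPair, dropFn_boolPair, polyFn_apply, ones]

/-- **Specification of the evaluator**: on `⟨w, y⟩` with `|y| = K + |w|·k` (`K = KP(|w|)`,
`k = kP(|w|)`) it answers `1` iff the modulus `r = ⟦y ↾ K⟧` is `≤ 1` or divides the value of the
polynomial of `w` at the point read off `y` after the modulus. [cite: Schwartz1980, §3] -/
theorem evalF_spec (w y : List Bool) (hy : y.length = KP.eval w.length + w.length * kP.eval w.length) :
    evalF KP kP (boolPair w y) = [true] ↔
      (bitsToNat (y.take (KP.eval w.length)) ≤ 1 ∨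
        ((bitsToNat (y.take (KP.eval w.length)) : ℤ) ∣
          MvPolynomial.eval (ptOf (kP.eval w.length) (Polynomial.X.eval w.length) (y.drop (KP.eval w.length)))
            (semPoly w))) := by
  set K := KP.eval w.length
  set k := kP.eval w.length
  set rb := y.take K with hrb
  rw [evalF, iteFn_apply (c := valGeTwoFn ∘ rRawF KP) (b := decide (2 ≤ bitsToNat rb))
    (by rw [Function.comp_apply, rRawF_boolPair]; rfl)]
  by_cases hr : 2 ≤ bitsToNat rb
  · rw [decide_eq_true hr, if_pos rfl]
    have hV : Polynomial.X.eval w.length = w.length := Polynomial.eval_X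
    have hseg : (y.drop K).length = Polynomial.X.eval w.length * k := by rw [List.length_drop, hy, hV]; omega
    have hvals : valsF KP kP (boolPair w y) =
        valEnc (bitsToNat rb) (ptOf k (Polynomial.X.eval w.length) (y.drop K))
          (gateValues ((rdGateCodes w).map (rdGate (Polynomial.X.eval w.length)))) := by
      rw [valsF, Function.comp_apply, outerInF, fanoutFn_apply, ctxF_boolPair, foldFn_boolPair]
      simp only [Function.comp_apply, fstF_boolPair]
      exact vals_fold_spec hV hr hseg _ (rdGateCodes w) (length_rdGateCodes_le w)
    have hout : outValF KP kP (boolPair w y) =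
        numR (bitsToNat rb) (MvPolynomial.eval (ptOf k (Polynomial.X.eval w.length) (y.drop K)) (semPoly w)) := by
      rw [outValF, Function.comp_apply, fanoutFn_apply, fanoutFn_apply, hvals, ctxF_boolPair]
      simp only [Function.comp_apply, fstF_boolPair]
      rw [opValF_spec hV hr hseg _ (by rw [gateValues_length, List.length_map]; exact length_rdGateCodes_le w)]
      rfl
    rw [Function.comp_apply, hout]
    constructor
    · intro h
      right
      have h' : numR (bitsToNat rb) (MvPolynomial.eval (ptOf k (Polynomial.X.eval w.length) (y.drop K)) (semPoly w)) = [] := by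
        simpa [isNilFn] using h
      exact (numR_eq_nil_iff (by omega) _).1 h'
    · rintro (h | h)
      · omega
      · rw [(numR_eq_nil_iff (by omega) _).2 h]; rfl
  · rw [show decide (2 ≤ bitsToNat rb) = false from decide_eq_false hr]
    simp only [Bool.false_eq_true, if_false, true_iff]
    left; omega

end FoldSpecs

/-! ### Public point/modulus evaluator (appended 2026-08-27): the same machine on an explicit context

For verifiers that evaluate a GUESSED circuit code at EXPLICIT points modulo an EXPLICIT modulus (the
`∃·BPP` protocols behind BIJL Thms 4–6: Kabanets–Impagliazzo's row-expansion chain checked modulo a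
guessed prime by random evaluation; "`p(A) ≠ 0`" for a guessed algebraic proof `p`), the evaluator is
offered on the context record itself: input `mkCtx rb w seg (1^k) = ⟨rb, ⟨w, ⟨seg, 1^k⟩⟩⟩` — modulus
bits `rb` (value `r ≥ 2`), code `w`, point segment `seg` of `|w|` blocks of `k` bits (coordinate
`i ↦ ⟦block i⟧ ∈ [0, 2^k)`, `ModularZeroTest.ptOf`) — output the numeral of
`(semPoly w)(pt) mod r` (`numR`). -/

section EvalAt

/-- **The point/modulus evaluator** on a context `⟨rb, ⟨w, ⟨seg, 1^k⟩⟩⟩`: the residue modulo `⟦rb⟧` of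
the value of the circuit read off `w` at the block point read off `seg` (the outer fold of `evalF`, fed
from the context instead of the coin string). [cite: AroraBarakCC2009, §1.3] -/
def evalAtF : List Bool → List Bool :=
  opValF ∘ fanoutFn (sndF ∘ sndF ∘ cW)
    (fanoutFn (foldFn stepG (fun _ => []) ∘ fanoutFn id (sndF ∘ fstF ∘ sndF ∘ cW)) id)

/-- **`evalAtF ∈ FP`.** [cite: AroraBarakCC2009, §1.3] -/
theorem evalAtF_mem_FP : evalAtF ∈ FP :=
  comp_mem_FP opValF_mem_FP
    (fanoutFn_mem_FP (comp_mem_FP sndF_mem_FP (comp_mem_FP sndF_mem_FP cW_mem_FP))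
      (fanoutFn_mem_FP
        (comp_mem_FP (foldFn_mem_FP stepG_mem_FP (const_mem_FP _) foldGrowth_stepG)
          (fanoutFn_mem_FP OracleCompose.id_mem_FP
            (comp_mem_FP sndF_mem_FP (comp_mem_FP fstF_mem_FP (comp_mem_FP sndF_mem_FP cW_mem_FP)))))
        OracleCompose.id_mem_FP))

/-- **Specification of `evalAtF`**: on `⟨rb, ⟨w, ⟨seg, 1^k⟩⟩⟩` with `⟦rb⟧ ≥ 2` and `|seg| = |w|·k` it
returns the numeral of `(semPoly w)(pt) mod ⟦rb⟧`, `pt i = ⟦block i of seg⟧`.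
[cite: Schwartz1980, §3] [cite: AroraBarakCC2009, §1.3] -/
theorem evalAtF_spec (rb w seg : List Bool) (k : ℕ) (hr : 2 ≤ bitsToNat rb)
    (hseg : seg.length = Polynomial.X.eval w.length * k) :
    evalAtF (mkCtx rb w seg (ones k)) =
      numR (bitsToNat rb) (MvPolynomial.eval (ptOf k (Polynomial.X.eval w.length) seg) (semPoly w)) := by
  have hV : Polynomial.X.eval w.length = w.length := Polynomial.eval_X
  have hvals : (foldFn stepG (fun _ => []) ∘ fanoutFn id (sndF ∘ fstF ∘ sndF ∘ cW)) (mkCtx rb w seg (ones k)) =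
      valEnc (bitsToNat rb) (ptOf k (Polynomial.X.eval w.length) seg)
        (gateValues ((rdGateCodes w).map (rdGate (Polynomial.X.eval w.length)))) := by
    rw [Function.comp_apply, fanoutFn_apply, foldFn_boolPair]
    simp only [Function.comp_apply, cW_mkCtx, id]
    exact vals_fold_spec hV hr hseg _ (rdGateCodes w) (length_rdGateCodes_le w)
  rw [evalAtF, Function.comp_apply, fanoutFn_apply, fanoutFn_apply, hvals]
  simp only [Function.comp_apply, cW_mkCtx, id]
  rw [opValF_spec hV hr hseg _ (by rw [gateValues_length, List.length_map]; exact length_rdGateCodes_le w)]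
  rfl

/-- **Value form**: `⟦evalAtF ⟨rb, ⟨w, ⟨seg, 1^k⟩⟩⟩⟧ = ((semPoly w)(pt) mod r)` as a natural number.
[cite: Schwartz1980, §3] -/
theorem bitsToNat_evalAtF (rb w seg : List Bool) (k : ℕ) (hr : 2 ≤ bitsToNat rb)
    (hseg : seg.length = Polynomial.X.eval w.length * k) :
    bitsToNat (evalAtF (mkCtx rb w seg (ones k))) =
      ((MvPolynomial.eval (ptOf k (Polynomial.X.eval w.length) seg) (semPoly w)) % (bitsToNat rb : ℤ)).toNat := by
  rw [evalAtF_spec rb w seg k hr hseg, bitsToNat_numR]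

/-- **Zero-test form**: the output is the empty numeral iff the modulus divides the value.
[cite: Schwartz1980, §3] -/
theorem evalAtF_eq_nil_iff (rb w seg : List Bool) (k : ℕ) (hr : 2 ≤ bitsToNat rb)
    (hseg : seg.length = Polynomial.X.eval w.length * k) :
    evalAtF (mkCtx rb w seg (ones k)) = [] ↔
      ((bitsToNat rb : ℤ) ∣ MvPolynomial.eval (ptOf k (Polynomial.X.eval w.length) seg) (semPoly w)) := by
  rw [evalAtF_spec rb w seg k hr hseg]
  exact numR_eq_nil_iff (by omega) _

/-- **The output is below the modulus** (as a value: `< ⟦rb⟧`; so poly-length states in folds over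
many evaluations). [cite: AroraBarakCC2009, §1.3] -/
theorem bitsToNat_evalAtF_lt (rb w seg : List Bool) (k : ℕ) (hr : 2 ≤ bitsToNat rb)
    (hseg : seg.length = Polynomial.X.eval w.length * k) :
    bitsToNat (evalAtF (mkCtx rb w seg (ones k))) < bitsToNat rb := by
  rw [bitsToNat_evalAtF rb w seg k hr hseg]
  have h0 : (0 : ℤ) < (bitsToNat rb : ℤ) := by exact_mod_cast (show 0 < bitsToNat rb by omega)
  have h1 := Int.emod_lt_of_pos
    (MvPolynomial.eval (ptOf k (Polynomial.X.eval w.length) seg) (semPoly w)) h0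
  have h2 := Int.emod_nonneg
    (MvPolynomial.eval (ptOf k (Polynomial.X.eval w.length) seg) (semPoly w)) (ne_of_gt h0)
  omega

end EvalAt

/-! ### The formal degree of the circuit read off a string (appended 2026-08-27)

Step 2 of BIJL's `∃BPP` algorithms ("Check that its formal degree is `≤ d(k)`, otherwise reject", ECCC
p.18) and the syntactic guard every evaluation-based identity test over `𝔽_p` needs: the FORMAL DEGREE
(`ArithCircuit.formalDegree`, Bürgisser's convention: input nodes `1`, sum = maximum, product = sum,
junk references `1`) of `rdCircuit V w`, computed in `FP` by the same two-level fold as the evaluator with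
`(ℕ, max, +)` in place of `(ℤ/r, +, ·)`, SATURATED at a cap `M = ⟦mb⟧ ≥ 1` carried in the modulus slot
of the context (saturation keeps every stored numeral below `|mb|` symbols, which is what the fold
brick's growth contract wants; semantically `min (·) M` commutes with `max` and with `+` followed by
`min (·) M`). The gate degrees are stored shifted by one (`degEnc`), so that the empty item read at a
junk reference decodes to the default formal degree `1`. -/

section FDeg

/-- The coded list of gate formal degrees, saturated at `M` and shifted by one. [folklore] -/
def degEnc (M : ℕ) (degs : List ℕ) : List Bool := encList (degs.map fun d => encodeNat (min d M + 1))

/-- Saturation `⟨x, mb⟩ ↦ min ⟦x⟧ ⟦mb⟧`, normalised. [folklore] -/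
def satF : List Bool → List Bool :=
  iteFn ltFn (addFn ∘ fanoutFn fstF (fun _ => [])) (addFn ∘ fanoutFn sndF (fun _ => []))

/-- The larger of two numerals `⟨a, b⟩`, normalised. [folklore] -/
def maxF : List Bool → List Bool :=
  iteFn ltFn (addFn ∘ fanoutFn sndF (fun _ => [])) (addFn ∘ fanoutFn fstF (fun _ => []))

/-- Formal degree of a gate reference `s = ⟨uc, ⟨dvals, dctx⟩⟩`: the stored item minus one, or `1`
at a junk reference (empty item). [cite: Burgisser2006, §2.2] -/
def refDegF : List Bool → List Bool :=
  iteFn (isNilFn ∘ gateBrF) (fun _ => [true]) (subFn ∘ fanoutFn gateBrF (fun _ => [true]))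

/-- **Formal degree of an operand** `s = ⟨uc, ⟨dvals, dctx⟩⟩` (saturated): a gate reference reads the
list, an input node has formal degree `1`. [cite: Burgisser2006, §2.2] -/
def opDegF : List Bool → List Bool := iteFn (headBitFn ∘ sUC) refDegF (fun _ => [true])

/-- Product step on degrees: `acc ↦ min (acc + deg(item)) M`. [cite: Burgisser2006, §2.2] -/
def stepPd : List Bool → List Bool :=
  satF ∘ fanoutFn (addFn ∘ fanoutFn pAcc (opDegF ∘ fanoutFn pItem pVC)) pR

/-- Sum step on degrees: `acc ↦ min (max acc deg(operand of item)) M`, the item being `⟨ccode, opcode⟩`.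
[cite: Burgisser2006, §2.2] -/
def stepSd : List Bool → List Bool :=
  satF ∘ fanoutFn (maxF ∘ fanoutFn pAcc (opDegF ∘ fanoutFn (sndF ∘ pItem) pVC)) pR

/-- **Formal degree of a gate** `t = ⟨g, ⟨dvals, dctx⟩⟩`, saturated (tag bit `1` = product = sum of
degrees, else maximum). [cite: Burgisser2006, §2.2] -/
def gateDegF : List Bool → List Bool :=
  iteFn (headBitFn ∘ fstF) (foldFn stepPd (fun _ => []) ∘ innerInF) (foldFn stepSd (fun _ => []) ∘ innerInF)

/-- Outer step on degrees: append the frame of `deg(g) + 1` to `dvals`. [cite: Burgisser2006, §2.2] -/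
def stepGd : List Bool → List Bool :=
  fun v => sndF (sndF v) ++ (frameF ∘ addFn ∘ fanoutFn (gateDegF ∘ gArgF) (fun _ => [true])) v

/-- The degree context of `⟨w, mb⟩`: `⟨mb, ⟨w, ⟨ε, ε⟩⟩⟩` (cap in the modulus slot, `w` as ruler). [folklore] -/
def dctxF : List Bool → List Bool := fanoutFn sndF (fanoutFn fstF (fun _ => boolPair [] []))

/-- The coded list of all (saturated, shifted) gate formal degrees of the circuit read off `w`, on
`⟨w, mb⟩`. [cite: Burgisser2006, §2.2] -/
def degValsF : List Bool → List Bool :=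
  foldFn stepGd (fun _ => []) ∘ fanoutFn dctxF (sndF ∘ fstF ∘ sndF ∘ fstF)

/-- **The formal degree of the circuit read off `w`, saturated at `⟦mb⟧`**, on `⟨w, mb⟩`, as a numeral.
[cite: Burgisser2006, §2.2] -/
def fdegF : List Bool → List Bool := opDegF ∘ fanoutFn (sndF ∘ sndF ∘ fstF) (fanoutFn degValsF dctxF)

/-- **The formal-degree test** on `⟨w, cb⟩`: the bit `[formalDegree (rdCircuit w) ≤ ⟦cb⟧]` (saturate at
`⟦cb⟧ + 1` and compare). [cite: BlaserIkenmeyerJindalLysikov2018, §6 (proof of Thm. 5, step 2)] -/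
def fdegLeF : List Bool → List Bool :=
  ltFn ∘ fanoutFn (fdegF ∘ fanoutFn fstF (addFn ∘ fanoutFn sndF (fun _ => [true])))
    (addFn ∘ fanoutFn sndF (fun _ => [true]))

/-! #### Membership in `FP` -/

/-- Plumbing (`satF_mem_FP`). [folklore] -/
private theorem satF_mem_FP : satF ∈ FP :=
  iteFn_mem_FP ltFn_mem_FP (comp_mem_FP addFn_mem_FP (fanoutFn_mem_FP fstF_mem_FP (const_mem_FP _)))
    (comp_mem_FP addFn_mem_FP (fanoutFn_mem_FP sndF_mem_FP (const_mem_FP _)))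

/-- Plumbing (`maxF_mem_FP`). [folklore] -/
private theorem maxF_mem_FP : maxF ∈ FP :=
  iteFn_mem_FP ltFn_mem_FP (comp_mem_FP addFn_mem_FP (fanoutFn_mem_FP sndF_mem_FP (const_mem_FP _)))
    (comp_mem_FP addFn_mem_FP (fanoutFn_mem_FP fstF_mem_FP (const_mem_FP _)))

/-- Plumbing (`refDegF_mem_FP`). [folklore] -/
private theorem refDegF_mem_FP : refDegF ∈ FP :=
  iteFn_mem_FP (comp_mem_FP isNilFn_mem_FP gateBrF_mem_FP) (const_mem_FP _)
    (comp_mem_FP subFn_mem_FP (fanoutFn_mem_FP gateBrF_mem_FP (const_mem_FP _)))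

/-- Plumbing (`opDegF_mem_FP`). [folklore] -/
private theorem opDegF_mem_FP : opDegF ∈ FP :=
  iteFn_mem_FP (comp_mem_FP headBitFn_mem_FP sUC_mem_FP) refDegF_mem_FP (const_mem_FP _)

/-- Plumbing (`stepPd_mem_FP`). [folklore] -/
private theorem stepPd_mem_FP : stepPd ∈ FP :=
  comp_mem_FP satF_mem_FP (fanoutFn_mem_FP (comp_mem_FP addFn_mem_FP (fanoutFn_mem_FP pAcc_mem_FP
    (comp_mem_FP opDegF_mem_FP (fanoutFn_mem_FP pItem_mem_FP pVC_mem_FP)))) pR_mem_FP)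

/-- Plumbing (`stepSd_mem_FP`). [folklore] -/
private theorem stepSd_mem_FP : stepSd ∈ FP :=
  comp_mem_FP satF_mem_FP (fanoutFn_mem_FP (comp_mem_FP maxF_mem_FP (fanoutFn_mem_FP pAcc_mem_FP
    (comp_mem_FP opDegF_mem_FP (fanoutFn_mem_FP (comp_mem_FP sndF_mem_FP pItem_mem_FP) pVC_mem_FP)))) pR_mem_FP)

/-- **Saturation is short**: `|satF ⟨x, mb⟩| ≤ |mb|`. [folklore] -/
private theorem length_satF_le (x mb : List Bool) : (satF (boolPair x mb)).length ≤ mb.length := by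
  unfold satF
  rw [iteFn_apply (show ltFn (boolPair x mb) = [_] from ltFn_boolPair x mb)]
  split_ifs with h
  · rw [Function.comp_apply, fanoutFn_apply, fstF_boolPair, addFn_boolPair, bitsToNat_nil, add_zero]
    have h' : bitsToNat x < bitsToNat mb := by simpa using h
    exact (length_encodeNat_mono h'.le).trans (length_encodeNat_bitsToNat_le mb)
  · rw [Function.comp_apply, fanoutFn_apply, sndF_boolPair, addFn_boolPair, bitsToNat_nil, add_zero]
    exact length_encodeNat_bitsToNat_le mb

/-- The product step outputs at most `|mb|` symbols. [folklore] -/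
private theorem length_stepPd_le (v : List Bool) : (stepPd v).length ≤ (pR v).length := by
  rw [stepPd, Function.comp_apply, fanoutFn_apply]; exact length_satF_le _ _

/-- The sum step outputs at most `|mb|` symbols. [folklore] -/
private theorem length_stepSd_le (v : List Bool) : (stepSd v).length ≤ (pR v).length := by
  rw [stepSd, Function.comp_apply, fanoutFn_apply]; exact length_satF_le _ _

/-- Plumbing (`foldGrowth_stepPd`). [folklore] -/
private theorem foldGrowth_stepPd : FoldGrowth 1 stepPd := fun v => by
  have h := (length_stepPd_le v).trans (length_pR_le v)
  nlinarith [h, Nat.zero_le (sndF (sndF v)).length, Nat.zero_le (fstF (sndF v)).length]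

/-- Plumbing (`foldGrowth_stepSd`). [folklore] -/
private theorem foldGrowth_stepSd : FoldGrowth 1 stepSd := fun v => by
  have h := (length_stepSd_le v).trans (length_pR_le v)
  nlinarith [h, Nat.zero_le (sndF (sndF v)).length, Nat.zero_le (fstF (sndF v)).length]

/-- Plumbing (`gateDegF_mem_FP`). [folklore] -/
private theorem gateDegF_mem_FP : gateDegF ∈ FP :=
  iteFn_mem_FP (comp_mem_FP headBitFn_mem_FP fstF_mem_FP)
    (comp_mem_FP (foldFn_mem_FP stepPd_mem_FP (const_mem_FP _) foldGrowth_stepPd) innerInF_mem_FP)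
    (comp_mem_FP (foldFn_mem_FP stepSd_mem_FP (const_mem_FP _) foldGrowth_stepSd) innerInF_mem_FP)

/-- **A gate degree is short**: `≤ |dctx|` symbols, for `t = ⟨g, ⟨dvals, dctx⟩⟩`. [folklore] -/
private theorem length_gateDegF_le (t : List Bool) : (gateDegF t).length ≤ (sndF (sndF t)).length := by
  have hR : ∀ item acc : List Bool, (pR (boolPair (innerInF t) (boolPair item acc))).length ≤ (sndF (sndF t)).length := by
    intro item acc
    have := length_fstF_sndF_le (sndF (sndF t))
    simp only [pR, cR, innerInF, Function.comp_apply, fanoutFn_apply, fstF_boolPair]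
    omega
  unfold gateDegF
  rw [iteFn_apply (show (headBitFn ∘ fstF) t = [_] from headBitFn_apply _)]
  split_ifs
  · rw [Function.comp_apply, foldFn_apply]
    exact length_foldl_le (fun acc a => (length_stepPd_le _).trans (hR a acc)) _ _ (by simp)
  · rw [Function.comp_apply, foldFn_apply]
    exact length_foldl_le (fun acc a => (length_stepSd_le _).trans (hR a acc)) _ _ (by simp)

/-- Plumbing (`stepGd_mem_FP`). [folklore] -/
private theorem stepGd_mem_FP : stepGd ∈ FP :=
  append_mem_FP (comp_mem_FP sndF_mem_FP sndF_mem_FP)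
    (comp_mem_FP frameF_mem_FP (comp_mem_FP addFn_mem_FP
      (fanoutFn_mem_FP (comp_mem_FP gateDegF_mem_FP gArgF_mem_FP) (const_mem_FP _))))

/-- Plumbing (`foldGrowth_stepGd`). [folklore] -/
private theorem foldGrowth_stepGd : FoldGrowth 6 stepGd := fun v => by
  have h1 := length_gateDegF_le (gArgF v)
  have hctx : (sndF (sndF (gArgF v))).length ≤ (fstF v).length := by
    have := length_fstF_sndF_le (fstF v)
    simp only [gArgF, fanoutFn_apply, sndF_boolPair, Function.comp_apply]
    omega
  have hadd : (addFn (boolPair (gateDegF (gArgF v)) [true])).length ≤ (gateDegF (gArgF v)).length + 2 := by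
    rw [addFn_boolPair]
    exact (Brick.length_encodeNat_add_le _ _).trans (by simp)
  have hlen : (stepGd v).length = (sndF (sndF v)).length + (2 * (addFn (boolPair (gateDegF (gArgF v)) [true])).length + 2) := by
    simp only [stepGd, Function.comp_apply, fanoutFn_apply, frameF_apply, List.length_append, length_boolPair,
      List.length_nil]
  rw [hlen]
  nlinarith [Nat.zero_le (fstF (sndF v)).length]

/-- Plumbing (`dctxF_mem_FP`). [folklore] -/
private theorem dctxF_mem_FP : dctxF ∈ FP :=
  fanoutFn_mem_FP sndF_mem_FP (fanoutFn_mem_FP fstF_mem_FP (const_mem_FP _))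

/-- Plumbing (`degValsF_mem_FP`). [folklore] -/
private theorem degValsF_mem_FP : degValsF ∈ FP :=
  comp_mem_FP (foldFn_mem_FP stepGd_mem_FP (const_mem_FP _) foldGrowth_stepGd)
    (fanoutFn_mem_FP dctxF_mem_FP
      (comp_mem_FP sndF_mem_FP (comp_mem_FP fstF_mem_FP (comp_mem_FP sndF_mem_FP fstF_mem_FP))))

/-- **`fdegF ∈ FP`.** [cite: AroraBarakCC2009, §1.3] -/
theorem fdegF_mem_FP : fdegF ∈ FP :=
  comp_mem_FP opDegF_mem_FP (fanoutFn_mem_FP (comp_mem_FP sndF_mem_FP (comp_mem_FP sndF_mem_FP fstF_mem_FP))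
    (fanoutFn_mem_FP degValsF_mem_FP dctxF_mem_FP))

/-- **`fdegLeF ∈ FP`.** [cite: AroraBarakCC2009, §1.3] -/
theorem fdegLeF_mem_FP : fdegLeF ∈ FP :=
  comp_mem_FP ltFn_mem_FP (fanoutFn_mem_FP
    (comp_mem_FP fdegF_mem_FP (fanoutFn_mem_FP fstF_mem_FP
      (comp_mem_FP addFn_mem_FP (fanoutFn_mem_FP sndF_mem_FP (const_mem_FP _)))))
    (comp_mem_FP addFn_mem_FP (fanoutFn_mem_FP sndF_mem_FP (const_mem_FP _))))

/-! #### Semantics -/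

/-- Saturated addition absorbs an inner saturation. [folklore] -/
private theorem min_add_min (S d M : ℕ) : min (min S M + min d M) M = min (S + d) M := by omega

/-- Saturated maximum absorbs an inner saturation. [folklore] -/
private theorem min_max_min (A d M : ℕ) : min (max (min A M) (min d M)) M = min (max A d) M := by omega

/-- `foldr max 0` as a left fold. [folklore] -/
private theorem foldl_max_eq : ∀ (l : List ℕ) (a : ℕ), l.foldl max a = max a (l.foldr max 0)
  | [], a => by simp
  | d :: l, a => by rw [List.foldl_cons, foldl_max_eq l, List.foldr_cons, max_assoc]

/-- Value of `satF`. [folklore] -/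
private theorem satF_boolPair (x mb : List Bool) :
    satF (boolPair x mb) = encodeNat (min (bitsToNat x) (bitsToNat mb)) := by
  unfold satF
  rw [iteFn_apply (show ltFn (boolPair x mb) = [_] from ltFn_boolPair x mb)]
  by_cases h : bitsToNat x < bitsToNat mb
  · rw [decide_eq_true h, if_pos rfl, Function.comp_apply, fanoutFn_apply, fstF_boolPair, addFn_boolPair,
      bitsToNat_nil, add_zero, min_eq_left h.le]
  · rw [decide_eq_false h, if_neg Bool.false_ne_true, Function.comp_apply, fanoutFn_apply, sndF_boolPair,
      addFn_boolPair, bitsToNat_nil, add_zero, min_eq_right (not_lt.1 h)]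

/-- Value of `maxF`. [folklore] -/
private theorem maxF_boolPair (a b : List Bool) :
    maxF (boolPair a b) = encodeNat (max (bitsToNat a) (bitsToNat b)) := by
  unfold maxF
  rw [iteFn_apply (show ltFn (boolPair a b) = [_] from ltFn_boolPair a b)]
  by_cases h : bitsToNat a < bitsToNat b
  · rw [decide_eq_true h, if_pos rfl, Function.comp_apply, fanoutFn_apply, sndF_boolPair, addFn_boolPair,
      bitsToNat_nil, add_zero, max_eq_right h.le]
  · rw [decide_eq_false h, if_neg Bool.false_ne_true, Function.comp_apply, fanoutFn_apply, fstF_boolPair,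
      addFn_boolPair, bitsToNat_nil, add_zero, max_eq_left (not_lt.1 h)]

variable {V M : ℕ} {w mb : List Bool}

/-- **Formal degree of an operand code** against the coded (saturated, shifted) degrees of the earlier
gates: `encodeNat (min (formalDegree) M)`. [cite: Burgisser2006, §2.2] -/
private theorem opDegF_spec (hM : M = bitsToNat mb) (hM1 : 1 ≤ M) (degs : List ℕ) (hL : degs.length ≤ w.length)
    (uc seg onesk : List Bool) :
    opDegF (boolPair uc (boolPair (degEnc M degs) (mkCtx mb w seg onesk))) =
      encodeNat (min ((rdOp V uc).formalDegree degs) M) := by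
  have h1 : encodeNat 1 = [true] := by decide
  rw [opDegF, iteFn_apply (c := headBitFn ∘ sUC) (b := uc.headD false)
    (by rw [Function.comp_apply, sUC, fstF_boolPair, headBitFn_apply])]
  unfold rdOp
  by_cases h0 : uc.headD false = true
  · -- gate reference
    rw [if_pos h0, if_pos h0]
    have hbr : gateBrF (boolPair uc (boolPair (degEnc M degs) (mkCtx mb w seg onesk))) =
        (degs.map fun d => encodeNat (min d M + 1)).getD (min (bitsToNat uc.tail) w.length) [] := by
      rw [gateBrF, Function.comp_apply, fanoutFn_apply, elemFn_boolPair, Function.comp_apply, fanoutFn_apply,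
        binToUnaryFn_boolPair]
      simp only [Function.comp_apply, sCtx, sVals, sUC, fstF_boolPair, sndF_boolPair, cW_mkCtx]
      rw [degEnc, elemOf_encList]
      simp only [ones, List.length_replicate]
    simp only [Operand.formalDegree]
    unfold refDegF
    by_cases hj : bitsToNat uc.tail < degs.length
    · have hget : (degs.map fun d => encodeNat (min d M + 1)).getD (min (bitsToNat uc.tail) w.length) [] =
          encodeNat (min (degs.getD (bitsToNat uc.tail) 1) M + 1) := by
        rw [min_eq_left (by omega), List.getD_eq_getElem?_getD, List.getElem?_map,
          List.getElem?_eq_getElem hj, List.getD_eq_getElem?_getD, List.getElem?_eq_getElem hj]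
        simp
      have hne : gateBrF (boolPair uc (boolPair (degEnc M degs) (mkCtx mb w seg onesk))) ≠ [] := by
        rw [hbr, hget]
        intro h
        have h' := congrArg bitsToNat h
        rw [bitsToNat_encodeNat, bitsToNat_nil] at h'
        omega
      rw [iteFn_apply (c := isNilFn ∘ gateBrF) (b := false)
        (by rw [Function.comp_apply, isNilFn, decide_eq_false hne]),
        if_neg Bool.false_ne_true, Function.comp_apply, fanoutFn_apply, hbr, hget, subFn_boolPair,
        bitsToNat_encodeNat, show bitsToNat [true] = 1 from by decide, Nat.add_sub_cancel]
    · have hget : (degs.map fun d => encodeNat (min d M + 1)).getD (min (bitsToNat uc.tail) w.length) [] = [] := by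
        rw [List.getD_eq_getElem?_getD, List.getElem?_eq_none (by rw [List.length_map]; omega)]
        rfl
      rw [iteFn_apply (c := isNilFn ∘ gateBrF) (b := true)
        (by rw [Function.comp_apply, isNilFn, hbr, hget, decide_eq_true rfl]),
        if_pos rfl, List.getD_eq_getElem?_getD, List.getElem?_eq_none (not_lt.1 hj)]
      show [true] = _
      rw [Option.getD_none, min_eq_left hM1, h1]
  · rw [if_neg h0, if_neg h0]
    have : (if uc.tail.headD false = true then Operand.const (rdInt uc.tail.tail)
        else if h : bitsToNat uc.tail.tail < V then Operand.var ⟨bitsToNat uc.tail.tail, h⟩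
        else (Operand.const 0 : Operand ℤ (Fin V))).formalDegree degs = 1 := by
      split_ifs <;> rfl
    rw [this, min_eq_left hM1, h1]

/-- Value of the product step on a structured argument. [folklore] -/
private theorem stepPd_boolPair (dvals dctx argsEnc a acc : List Bool) :
    stepPd (boolPair (boolPair (boolPair dvals dctx) argsEnc) (boolPair a acc)) =
      satF (boolPair (addFn (boolPair acc (opDegF (boolPair a (boolPair dvals dctx))))) (cR dctx)) := by
  simp [stepPd, fanoutFn_apply, pAcc, pItem, pVC, pR]

/-- Value of the sum step on a structured argument. [folklore] -/
private theorem stepSd_boolPair (dvals dctx argsEnc a acc : List Bool) :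
    stepSd (boolPair (boolPair (boolPair dvals dctx) argsEnc) (boolPair a acc)) =
      satF (boolPair (maxF (boolPair acc (opDegF (boolPair (sndF a) (boolPair dvals dctx))))) (cR dctx)) := by
  simp [stepSd, fanoutFn_apply, pAcc, pItem, pVC, pR]

/-- **The product fold computes the saturated sum of the degrees.** [cite: Burgisser2006, §2.2] -/
private theorem prod_deg_fold_spec (hM : M = bitsToNat mb) (hM1 : 1 ≤ M) (degs : List ℕ) (hL : degs.length ≤ w.length)
    (seg onesk argsEnc : List Bool) : ∀ (I : List (List Bool)) (S : ℕ),
      I.foldl (fun acc a => stepPd (boolPair (boolPair (boolPair (degEnc M degs) (mkCtx mb w seg onesk)) argsEnc)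
        (boolPair a acc))) (encodeNat (min S M)) =
      encodeNat (min (S + (I.map fun a => (rdOp V a).formalDegree degs).sum) M)
  | [], S => by simp
  | a :: I, S => by
    rw [List.foldl_cons, stepPd_boolPair, opDegF_spec (V := V) hM hM1 degs hL a, cR_mkCtx, addFn_boolPair,
      bitsToNat_encodeNat, bitsToNat_encodeNat, satF_boolPair, bitsToNat_encodeNat, ← hM, min_add_min,
      prod_deg_fold_spec hM hM1 degs hL seg onesk argsEnc I, List.map_cons, List.sum_cons, add_assoc]

/-- **The sum fold computes the saturated maximum of the degrees.** [cite: Burgisser2006, §2.2] -/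
private theorem sum_deg_fold_spec (hM : M = bitsToNat mb) (hM1 : 1 ≤ M) (degs : List ℕ) (hL : degs.length ≤ w.length)
    (seg onesk argsEnc : List Bool) : ∀ (I : List (List Bool)) (A : ℕ),
      I.foldl (fun acc a => stepSd (boolPair (boolPair (boolPair (degEnc M degs) (mkCtx mb w seg onesk)) argsEnc)
        (boolPair a acc))) (encodeNat (min A M)) =
      encodeNat (min ((I.map fun a => (rdOp V (sndF a)).formalDegree degs).foldl max A) M)
  | [], A => by simp
  | a :: I, A => by
    rw [List.foldl_cons, stepSd_boolPair, opDegF_spec (V := V) hM hM1 degs hL (sndF a), cR_mkCtx, maxF_boolPair,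
      bitsToNat_encodeNat, bitsToNat_encodeNat, satF_boolPair, bitsToNat_encodeNat, ← hM, min_max_min,
      sum_deg_fold_spec hM hM1 degs hL seg onesk argsEnc I, List.map_cons, List.foldl_cons]

/-- **The gate brick computes the saturated formal degree of the gate.** [cite: Burgisser2006, §2.2] -/
private theorem gateDegF_spec (hM : M = bitsToNat mb) (hM1 : 1 ≤ M) (degs : List ℕ) (hL : degs.length ≤ w.length)
    (seg onesk g : List Bool) :
    gateDegF (boolPair g (boolPair (degEnc M degs) (mkCtx mb w seg onesk))) =
      encodeNat (min ((rdGate V g).formalDegree degs) M) := by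
  rw [gateDegF, iteFn_apply (c := headBitFn ∘ fstF) (b := g.headD false)
    (by rw [Function.comp_apply, fstF_boolPair, headBitFn_apply])]
  unfold rdGate rdItems
  by_cases ht : g.headD false = true
  · rw [if_pos ht, if_pos ht, Function.comp_apply, innerInF_boolPair, foldFn_boolPair,
      show ([] : List Bool) = encodeNat (min 0 M) from by rw [Nat.zero_min]; rfl,
      prod_deg_fold_spec (V := V) hM hM1 degs hL seg onesk, zero_add]
    simp only [Gate.formalDegree, List.map_map]
    rfl
  · rw [if_neg ht, if_neg ht, Function.comp_apply, innerInF_boolPair, foldFn_boolPair,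
      show ([] : List Bool) = encodeNat (min 0 M) from by rw [Nat.zero_min]; rfl,
      sum_deg_fold_spec (V := V) hM hM1 degs hL seg onesk]
    simp only [Gate.formalDegree, List.map_map, foldl_max_eq, Nat.zero_max]
    rfl

/-- Value of the outer step on a structured argument. [folklore] -/
private theorem stepGd_boolPair (dctx gatesEnc g dvals : List Bool) :
    stepGd (boolPair (boolPair dctx gatesEnc) (boolPair g dvals)) =
      dvals ++ boolPair (addFn (boolPair (gateDegF (boolPair g (boolPair dvals dctx))) [true])) [] := by
  simp [stepGd, gArgF, fanoutFn_apply, frameF_apply]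

/-- **The outer fold computes the coded list of all (saturated, shifted) gate formal degrees.**
[cite: Burgisser2006, §2.2] -/
private theorem degs_fold_spec (hM : M = bitsToNat mb) (hM1 : 1 ≤ M) (seg onesk gatesEnc : List Bool) :
    ∀ codes : List (List Bool), codes.length ≤ w.length →
      codes.foldl (fun acc g => stepGd (boolPair (boolPair (mkCtx mb w seg onesk) gatesEnc) (boolPair g acc))) [] =
        degEnc M (gateFormalDegrees (codes.map (rdGate V))) := by
  intro codes
  induction codes using List.reverseRecOn with
  | nil => intro _; simp [degEnc, gateFormalDegrees]
  | append_singleton codes g ih =>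
    intro hlen
    rw [List.length_append, List.length_singleton] at hlen
    have h1 : bitsToNat [true] = 1 := by decide
    rw [List.foldl_append, ih (by omega), List.foldl_cons, List.foldl_nil, stepGd_boolPair,
      gateDegF_spec (V := V) hM hM1 _ (by rw [gateFormalDegrees_length, List.length_map]; omega),
      addFn_boolPair, bitsToNat_encodeNat, h1, List.map_append, List.map_singleton,
      gateFormalDegrees_append_singleton, degEnc, degEnc, List.map_append, List.map_singleton,
      encList_append_singleton]

/-- Value of the degree context. [folklore] -/
private theorem dctxF_boolPair (w mb : List Bool) : dctxF (boolPair w mb) = mkCtx mb w [] [] := by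
  simp [dctxF, mkCtx, fanoutFn_apply]

/-- **Specification of `fdegF`**: on `⟨w, mb⟩` with `⟦mb⟧ ≥ 1` it returns the numeral of
`min (formalDegree (rdCircuit V w)) ⟦mb⟧` (for every `V`: formal degrees do not see the variable bound).
[cite: Burgisser2006, §2.2] -/
theorem fdegF_spec (V : ℕ) (w mb : List Bool) (hM1 : 1 ≤ bitsToNat mb) :
    fdegF (boolPair w mb) = encodeNat (min (rdCircuit V w).formalDegree (bitsToNat mb)) := by
  have hvals : degValsF (boolPair w mb) = degEnc (bitsToNat mb) (gateFormalDegrees ((rdGateCodes w).map (rdGate V))) := by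
    rw [degValsF, Function.comp_apply, fanoutFn_apply, dctxF_boolPair, foldFn_boolPair]
    simp only [Function.comp_apply, fstF_boolPair]
    exact degs_fold_spec (V := V) rfl hM1 [] [] _ (rdGateCodes w) (length_rdGateCodes_le w)
  rw [fdegF, Function.comp_apply, fanoutFn_apply, fanoutFn_apply, hvals, dctxF_boolPair]
  simp only [Function.comp_apply, fstF_boolPair]
  rw [opDegF_spec (V := V) rfl hM1 _ (by rw [gateFormalDegrees_length, List.length_map]; exact length_rdGateCodes_le w)]
  rfl

/-- **Specification of the formal-degree test**: `fdegLeF ⟨w, cb⟩ = [formalDegree (rdCircuit V w) ≤ ⟦cb⟧]`.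
[cite: BlaserIkenmeyerJindalLysikov2018, §6 (proof of Thm. 5, step 2)] [cite: Burgisser2006, §2.2] -/
theorem fdegLeF_spec (V : ℕ) (w cb : List Bool) :
    fdegLeF (boolPair w cb) = [decide ((rdCircuit V w).formalDegree ≤ bitsToNat cb)] := by
  have h1 : bitsToNat [true] = 1 := by decide
  rw [fdegLeF, Function.comp_apply, fanoutFn_apply, ltFn_boolPair]
  simp only [Function.comp_apply, fanoutFn_apply, fstF_boolPair, sndF_boolPair, addFn_boolPair, h1,
    bitsToNat_encodeNat]
  rw [fdegF_spec V w _ (by rw [bitsToNat_encodeNat]; omega), bitsToNat_encodeNat, bitsToNat_encodeNat]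
  congr 1
  by_cases h : (rdCircuit V w).formalDegree ≤ bitsToNat cb
  · rw [decide_eq_true h, decide_eq_true (by rw [min_eq_left (by omega)]; omega)]
  · rw [decide_eq_false h, decide_eq_false (by rw [min_eq_right (by omega)]; omega)]

/-- **The test is one-bit.** [cite: AroraBarakCC2009, §1.3] -/
theorem fdegLeF_oneBit (z : List Bool) : fdegLeF z = [true] ∨ fdegLeF z = [false] := by
  have hb : ∀ b : Bool, [b] = [true] ∨ [b] = [false] := by decide
  rw [fdegLeF, Function.comp_apply, fanoutFn_apply, ltFn_boolPair]
  exact hb _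

/-- **On a genuine code word the test reads the circuit's own formal degree** (`m ≤ V`).
[cite: BlaserIkenmeyerJindalLysikov2018, §6 (proof of Thm. 5, step 2)] -/
theorem fdegLeF_circuitWord {m V : ℕ} (h : m ≤ V) (C : ArithCircuit ℤ (Fin m)) (cb : List Bool) :
    fdegLeF (boolPair (KIReduction.circuitWord m C) cb) = [decide (C.formalDegree ≤ bitsToNat cb)] := by
  rw [fdegLeF_spec V, rdCircuit_circuitWord h, formalDegree_rename]

end FDeg

end CircuitCode

end Literature.Computability.AlgebraicComplexity

end
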